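import Summits.CriticalPhenomena.PercolationContinuityZ3.Theorems.PercNearOneGluingNoHeavyLowerTailKnQuestion8CoefficientwiseCoreClassKernelMixPathTransfer
import HarnessLib

/-!
# The fibre up-set lemma, I: the analytic core of the `++` regime (threshold injections along the observer's arc)

Support file (`--supports stmt-CriticalPhenomena-4575`, closed), prover `prim-cplus-coupling` (gen 39).  No definitions, no notations, no named facts,
no sorries; standard axioms.  Memo `prim-cplus-coupling/A5-COUPLING-gen39.md` §2.3.

Context.  THEOREM IET-CYCLE (memo §3) rests on two fibre lemmas for the fibre `{W blue} × 2^A` of a cycle `W ⊔ A` through `u, b`.  The FIBRE INJECTION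
LEMMA is `…KernelMixFibreInjection`.  The FIBRE UP-SET LEMMA ('PF4′', memo §2.3) says: for every UP-SET `F` of colourings of the arc `A`,
`Σ_{η ∈ F∖{A}} (hᵃXη − hᵇYη)(kᵃXη − kᵇYη) + Σ_{ζ ∈ F∖{∅}} h(Gζ)k(Gζ) ≥ 0` (partners `ζ ∪ W` of the points of `F` only, the all-red point included,
NO M-point — the cube lemma of gen 37 needs the M-point, and without the all-red point the statement is false: CONJECTURE PF′ refuted, memo §1).  After the
regime split (`…KernelMixRegimeReduction`: levels reduced by their values on `{u}`) its heart is the `++` regime, whose proof is NOT a Harris inequality but a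
family of THRESHOLD INJECTIONS `ψ_m : η ↦ η ∪ T_m` (`T_m` = the last `m` edges of the arc): the blue `b`-run of a demand point is exchanged for the red
`b`-run of a point of `F` above it, threshold by threshold, and the only overcharged point (the top `A`) is paid jointly with the co-atom `A ∖ T_1`.
This file proves that heart in ABSTRACT, purely real-variable form (the cycle enters through the chain `T_m`, the run indices `jb, jr` and inequalities):
* `Coefficientwise.fibre_sum_le_sum_of_injOn_wt` — weighted reindexing along an injection;
* `Coefficientwise.fibre_telescope` — `Σ_{m ≤ j} Δ_m = Q(j)` for the increments `Δ` of `Q : ℕ → ℝ`;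
* `Coefficientwise.fibreUpset_core` — **the `++` core**: with nonnegative 'reduced' levels `a, c` (demand, monotone in `η`, zero off `Dom`), `q ≤ Qf∘jb`,
  `p ≤ Pf∘jb` on `Dom` (blue-run thresholds), partner levels `Hs ≥ a, Pf∘jr` and `Ks ≥ c, Qf∘jr` (red-run thresholds), `Hs, Ks` equal at `Q` and `Q ∖ T_1`:
  `0 ≤ Σ_{η ∈ F∖{Q}} (a c − a q − c p)(η) + Σ_{ζ ∈ F∖{∅}} Hs(ζ)Ks(ζ)`.
[cite: KozmaNitzan2024, Questions 8–9 (§5.5 p. 36) (context: the Question-8 pocket covariance programme)]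
-/

namespace Summit.CriticalPhenomena.PercolationContinuityZ3.Theorems

open Finset Literature.Probability.Percolation

namespace Coefficientwise

variable {ι V : Type*}

/-- Weighted reindexing along an injection: if `e` is injective on `s`, maps `s` into `t`, `f a ≤ g (e a)` on `s` and `g ≥ 0` on `t`, then
`Σ_{a ∈ s} f a ≤ Σ_{b ∈ t} g b`. [cite: KozmaNitzan2024, §5.5 (context only; folklore)] -/
theorem fibre_sum_le_sum_of_injOn_wt {κ μ : Type*} [DecidableEq μ] {s : Finset κ} {t : Finset μ}
    (e : κ → μ) (he : Set.InjOn e s) (hst : ∀ a ∈ s, e a ∈ t) (f : κ → ℝ) (g : μ → ℝ)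
    (hfg : ∀ a ∈ s, f a ≤ g (e a)) (hg : ∀ b ∈ t, 0 ≤ g b) :
    ∑ a ∈ s, f a ≤ ∑ b ∈ t, g b := by
  calc ∑ a ∈ s, f a ≤ ∑ a ∈ s, g (e a) := Finset.sum_le_sum hfg
    _ = ∑ b ∈ s.image e, g b := (Finset.sum_image (f := g) he).symm
    _ ≤ ∑ b ∈ t, g b := Finset.sum_le_sum_of_subset_of_nonneg (Finset.image_subset_iff.2 hst) fun b hb _ => hg b hb

/-- Telescoping of increments: with `Δ 0 = Q 0` and `Δ m = Q m − Q (m−1)` (`m ≥ 1`), `Σ_{m < j+1} Δ m = Q j`.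
[cite: KozmaNitzan2024, §5.5 (context only; elementary)] -/
theorem fibre_telescope (Qf : ℕ → ℝ) (j : ℕ) :
    ∑ m ∈ Finset.range (j + 1), (if m = 0 then Qf 0 else Qf m - Qf (m - 1)) = Qf j := by
  induction j with
  | zero => simp
  | succ j ih =>
    rw [Finset.sum_range_succ, ih]
    simp

/-- **The `++` core of the fibre up-set lemma (abstract).**  Data: a cube `2^Q` (`Q ≠ ∅`), an up-closed family `F ∋ Q` of subsets of `Q`, a sub-family
`Dom ⊆ F ∖ {Q}` of nonempty sets (the demand points with a nontrivial red cluster), a chain `∅ = T 0 ⊆ T 1 ⊆ ⋯` of subsets of `Q` with `T 1 ≠ ∅`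
(suffixes of the arc), indices `jb` (blue `b`-run: `η ∩ T (jb η) = ∅`) on `Dom` and `jr` (red `b`-run: `T m ⊆ ζ ⇒ m ≤ jr ζ`) on `F`, both `≤ L`;
nonnegative reals: demand levels `a, c` (monotone along `⊆`, zero off `Dom` and at `∅`), demand excesses `q ≤ Qf (jb ·)`, `p ≤ Pf (jb ·)` on `Dom`
(`Qf, Pf : ℕ → ℝ` nondecreasing, `Qf 0, Pf 0 ≥ 0`), partner levels `Hs ≥ a`, `Ks ≥ c` with `Qf (jr ζ) ≤ Ks ζ`, `Pf (jr ζ) ≤ Hs ζ` on `F`,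
`Qf L ≤ Ks Q`, `Pf L ≤ Hs Q`, and `Hs (Q ∖ T 1) = Hs Q`, `Ks (Q ∖ T 1) = Ks Q`.  Then
`0 ≤ Σ_{η ∈ F∖{Q}} (a η c η − a η q η − c η p η) + Σ_{ζ ∈ F∖{∅}} Hs ζ Ks ζ`.
Proof: `a η q η ≤ a η Σ_{m ≤ jb η} ΔQ_m`; for each `m` the map `η ↦ η ∪ T m` is injective on `{m ≤ jb η}` into `{ζ ∈ F : T m ⊆ ζ}` with
`a η ≤ a(η ∪ T m)`, except that the top `Q` is charged only `a(Q ∖ T 1)·ΔQ_m`; resumming, each `ζ ≠ Q` receives at most `a ζ · Qf (jr ζ) ≤ a ζ Ks ζ`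
(and `Q ∖ T 1` only `a · Qf 0`), so `Hs Ks + a c − a Ks − c Hs = (Hs − a)(Ks − c) ≥ 0` pays, and `{Q ∖ T 1, Q}` pay jointly.
[cite: KozmaNitzan2024, Questions 8–9 (§5.5 p. 36) (context)] -/
theorem fibreUpset_core [DecidableEq ι] (Q : Finset ι) (hQne : Q.Nonempty) (F : Finset (Finset ι))
    (hFQ : ∀ η ∈ F, η ⊆ Q) (hFup : ∀ η ∈ F, ∀ ζ : Finset ι, η ⊆ ζ → ζ ⊆ Q → ζ ∈ F) (hQF : Q ∈ F)
    (Dom : Finset (Finset ι)) (hDomF : ∀ η ∈ Dom, η ∈ F ∧ η ≠ Q) (hDom0 : ∀ η ∈ Dom, η ≠ ∅)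
    (L : ℕ) (T : ℕ → Finset ι) (hT0 : T 0 = ∅) (hTmono : ∀ m m', m ≤ m' → T m ⊆ T m') (hTQ : ∀ m, T m ⊆ Q) (hT1 : (T 1).Nonempty)
    (jb : Finset ι → ℕ) (hjbL : ∀ η ∈ Dom, jb η ≤ L) (hjbT : ∀ η ∈ Dom, Disjoint η (T (jb η)))
    (jr : Finset ι → ℕ) (hjrL : ∀ ζ ∈ F, jr ζ ≤ L) (hjr : ∀ ζ ∈ F, ∀ m, m ≤ L → T m ⊆ ζ → m ≤ jr ζ)
    (a c q p : Finset ι → ℝ) (ha0 : ∀ η, 0 ≤ a η) (hc0 : ∀ η, 0 ≤ c η) (hq0 : ∀ η, 0 ≤ q η) (hp0 : ∀ η, 0 ≤ p η)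
    (hamono : ∀ η ζ : Finset ι, η ⊆ ζ → ζ ⊆ Q → a η ≤ a ζ) (hcmono : ∀ η ζ : Finset ι, η ⊆ ζ → ζ ⊆ Q → c η ≤ c ζ)
    (haoff : ∀ η ∈ F, η ≠ Q → η ∉ Dom → a η = 0 ∧ c η = 0) (ha_empty : a ∅ = 0 ∧ c ∅ = 0)
    (Qf Pf : ℕ → ℝ) (hQf0 : 0 ≤ Qf 0) (hPf0 : 0 ≤ Pf 0) (hQfmono : Monotone Qf) (hPfmono : Monotone Pf)
    (hqjb : ∀ η ∈ Dom, q η ≤ Qf (jb η)) (hpjb : ∀ η ∈ Dom, p η ≤ Pf (jb η))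
    (Hs Ks : Finset ι → ℝ) (hHa : ∀ ζ, ζ ⊆ Q → a ζ ≤ Hs ζ) (hKc : ∀ ζ, ζ ⊆ Q → c ζ ≤ Ks ζ)
    (hKjr : ∀ ζ ∈ F, Qf (jr ζ) ≤ Ks ζ) (hHjr : ∀ ζ ∈ F, Pf (jr ζ) ≤ Hs ζ)
    (hKL : Qf L ≤ Ks Q) (hHL : Pf L ≤ Hs Q) (hHstar : Hs (Q \ T 1) = Hs Q) (hKstar : Ks (Q \ T 1) = Ks Q) :
    0 ≤ (∑ η ∈ F.erase Q, (a η * c η - a η * q η - c η * p η)) + ∑ ζ ∈ F.erase ∅, Hs ζ * Ks ζ := by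
  classical
  -- increments of the threshold functions
  set ΔQ : ℕ → ℝ := fun m => if m = 0 then Qf 0 else Qf m - Qf (m - 1) with hΔQ
  set ΔP : ℕ → ℝ := fun m => if m = 0 then Pf 0 else Pf m - Pf (m - 1) with hΔP
  have hΔQ0 : ∀ m, 0 ≤ ΔQ m := by
    intro m; simp only [hΔQ]; split_ifs with hm
    · exact hQf0
    · exact sub_nonneg.mpr (hQfmono (Nat.sub_le m 1))
  have hΔP0 : ∀ m, 0 ≤ ΔP m := by
    intro m; simp only [hΔP]; split_ifs with hm
    · exact hPf0
    · exact sub_nonneg.mpr (hPfmono (Nat.sub_le m 1))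
  -- telescoping over an initial segment of `range (L+1)`
  have tele : ∀ (Δ : ℕ → ℝ) (Rf : ℕ → ℝ), (∀ m, Δ m = if m = 0 then Rf 0 else Rf m - Rf (m - 1)) → ∀ j, j ≤ L →
      ∑ m ∈ Finset.range (L + 1), (if m ≤ j then Δ m else 0) = Rf j := by
    intro Δ Rf hΔ j hj
    rw [← Finset.sum_filter]
    have hf : (Finset.range (L + 1)).filter (fun m => m ≤ j) = Finset.range (j + 1) := by
      ext m; simp only [Finset.mem_filter, Finset.mem_range]; omega
    rw [hf]
    have := fibre_telescope Rf j
    rw [← this]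
    exact Finset.sum_congr rfl fun m _ => hΔ m
  set D : Finset (Finset ι) := F.erase Q with hD
  set R : Finset (Finset ι) := (F.erase ∅).erase Q with hR
  set ηs : Finset ι := Q \ T 1 with hηs
  set astar : ℝ := if ηs ∈ F then a ηs else 0 with hastar
  set cstar : ℝ := if ηs ∈ F then c ηs else 0 with hcstar
  have hastar0 : 0 ≤ astar := by simp only [hastar]; split_ifs <;> [exact ha0 _; exact le_refl 0]
  have hcstar0 : 0 ≤ cstar := by simp only [hcstar]; split_ifs <;> [exact hc0 _; exact le_refl 0]
  have hηsQ : ηs ⊆ Q := Finset.sdiff_subset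
  have hηsne : ηs ≠ Q := by
    obtain ⟨x, hx⟩ := hT1
    intro hEq
    have : x ∈ ηs := by rw [hEq]; exact hTQ 1 hx
    exact (Finset.mem_sdiff.mp this).2 hx
  have hmemD : ∀ η, η ∈ D ↔ η ∈ F ∧ η ≠ Q := by
    intro η; simp only [hD, Finset.mem_erase]; tauto
  have hmemR : ∀ ζ, ζ ∈ R ↔ ζ ∈ F ∧ ζ ≠ ∅ ∧ ζ ≠ Q := by
    intro ζ; simp only [hR, Finset.mem_erase]; tauto
  have hDomD : Dom ⊆ D := fun η hη => (hmemD η).mpr (hDomF η hη)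
  have hRD : R ⊆ D := fun ζ hζ => (hmemD ζ).mpr ⟨((hmemR ζ).mp hζ).1, ((hmemR ζ).mp hζ).2.2⟩
  -- the threshold sums received by a partner
  set SQ : Finset ι → ℝ := fun ζ => ∑ m ∈ Finset.range (L + 1), (if T m ⊆ ζ then ΔQ m else 0) with hSQ
  set SP : Finset ι → ℝ := fun ζ => ∑ m ∈ Finset.range (L + 1), (if T m ⊆ ζ then ΔP m else 0) with hSP
  have hS_le : ∀ (Δ : ℕ → ℝ) (Rf : ℕ → ℝ), (∀ m, Δ m = if m = 0 then Rf 0 else Rf m - Rf (m - 1)) → (∀ m, 0 ≤ Δ m) →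
      ∀ ζ ∈ F, ∑ m ∈ Finset.range (L + 1), (if T m ⊆ ζ then Δ m else 0) ≤ Rf (jr ζ) := by
    intro Δ Rf hΔ hΔ0 ζ hζ
    rw [← tele Δ Rf hΔ (jr ζ) (hjrL ζ hζ)]
    refine Finset.sum_le_sum fun m hm => ?_
    have hmL : m ≤ L := Nat.lt_succ_iff.mp (Finset.mem_range.mp hm)
    by_cases hT : T m ⊆ ζ
    · rw [if_pos hT, if_pos (hjr ζ hζ m hmL hT)]
    · rw [if_neg hT]; split_ifs <;> [exact hΔ0 m; exact le_refl 0]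
  have hS_star : ∀ (Δ : ℕ → ℝ) (Rf : ℕ → ℝ), (∀ m, Δ m = if m = 0 then Rf 0 else Rf m - Rf (m - 1)) →
      ∑ m ∈ Finset.range (L + 1), (if T m ⊆ ηs then Δ m else 0) = Rf 0 := by
    intro Δ Rf hΔ
    have key : ∀ m ∈ Finset.range (L + 1), (if T m ⊆ ηs then Δ m else 0) = if m = 0 then Rf 0 else 0 := by
      intro m _
      by_cases hm : m = 0
      · subst hm; rw [if_pos (by rw [hT0]; exact Finset.empty_subset _), if_pos rfl, hΔ 0, if_pos rfl]
      · have hT : ¬ T m ⊆ ηs := by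
          intro hsub
          obtain ⟨x, hx⟩ := hT1
          have hx' : x ∈ T m := hTmono 1 m (Nat.one_le_iff_ne_zero.mpr hm) hx
          exact (Finset.mem_sdiff.mp (hsub hx')).2 hx
        rw [if_neg hT, if_neg hm]
    rw [Finset.sum_congr rfl key, Finset.sum_ite_eq']
    simp
  -- STEP 1: the k-cross sum routed along the threshold injections
  have cross : ∀ (lev ex : Finset ι → ℝ) (Δ : ℕ → ℝ) (Rf : ℕ → ℝ) (star : ℝ),
      (∀ η, 0 ≤ lev η) → (∀ η, 0 ≤ ex η) → (∀ η ζ : Finset ι, η ⊆ ζ → ζ ⊆ Q → lev η ≤ lev ζ) →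
      (∀ η ∈ F, η ≠ Q → η ∉ Dom → lev η = 0) → (∀ η ∈ Dom, ex η ≤ Rf (jb η)) →
      (∀ m, Δ m = if m = 0 then Rf 0 else Rf m - Rf (m - 1)) → (∀ m, 0 ≤ Δ m) →
      (star = if ηs ∈ F then lev ηs else 0) →
      ∑ η ∈ D, lev η * ex η
        ≤ (∑ ζ ∈ R, lev ζ * ∑ m ∈ Finset.range (L + 1), (if T m ⊆ ζ then Δ m else 0)) + star * (Rf L - Rf 0) := by
    intro lev ex Δ Rf star hlev0 hex0 hlevmono hlevoff hexjb hΔ hΔ0 hstar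
    have hstar0 : 0 ≤ star := by rw [hstar]; split_ifs <;> [exact hlev0 _; exact le_refl 0]
    -- (A) restrict to Dom and bound ex by the thresholds
    have hA : ∑ η ∈ D, lev η * ex η ≤ ∑ η ∈ Dom, lev η * Rf (jb η) := by
      have e1 : ∑ η ∈ Dom, lev η * ex η = ∑ η ∈ D, lev η * ex η := by
        refine Finset.sum_subset hDomD fun η hηD hηDom => ?_
        obtain ⟨hηF, hηQ⟩ := (hmemD η).mp hηD
        rw [hlevoff η hηF hηQ hηDom, zero_mul]
      rw [← e1]
      exact Finset.sum_le_sum fun η hη => mul_le_mul_of_nonneg_left (hexjb η hη) (hlev0 η)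
    -- (B) expand Rf (jb η) into thresholds and exchange the sums
    have hB : ∑ η ∈ Dom, lev η * Rf (jb η)
        = ∑ m ∈ Finset.range (L + 1), Δ m * ∑ η ∈ Dom.filter (fun η => m ≤ jb η), lev η := by
      have e1 : ∀ η ∈ Dom, lev η * Rf (jb η) = ∑ m ∈ Finset.range (L + 1), (if m ≤ jb η then Δ m * lev η else 0) := by
        intro η hη
        rw [← tele Δ Rf hΔ (jb η) (hjbL η hη), Finset.mul_sum]
        refine Finset.sum_congr rfl fun m _ => ?_
        split_ifs <;> ring
      rw [Finset.sum_congr rfl e1, Finset.sum_comm]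
      refine Finset.sum_congr rfl fun m _ => ?_
      rw [Finset.sum_filter, Finset.mul_sum]
      refine Finset.sum_congr rfl fun η _ => ?_
      split_ifs <;> ring
    -- (C) per threshold: the injection η ↦ η ∪ T m
    have hC : ∀ m ∈ Finset.range (L + 1), ∑ η ∈ Dom.filter (fun η => m ≤ jb η), lev η
        ≤ (∑ ζ ∈ R.filter (fun ζ => T m ⊆ ζ), lev ζ) + (if m = 0 then 0 else star) := by
      intro m hm
      set g : Finset ι → ℝ := fun ζ => if ζ = Q then (if m = 0 then 0 else star) else lev ζ with hg
      have hdisj : ∀ η ∈ Dom.filter (fun η => m ≤ jb η), Disjoint η (T m) := by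
        intro η hη
        obtain ⟨hηDom, hmj⟩ := Finset.mem_filter.mp hη
        exact (hjbT η hηDom).mono_right (hTmono m (jb η) hmj)
      have step := fibre_sum_le_sum_of_injOn_wt (s := Dom.filter (fun η => m ≤ jb η)) (t := (F.erase ∅).filter (fun ζ => T m ⊆ ζ))
        (fun η => η ∪ T m) ?_ ?_ lev g ?_ ?_
      · -- rewrite the target sum: split off ζ = Q
        have hQt : Q ∈ (F.erase ∅).filter (fun ζ => T m ⊆ ζ) :=
          Finset.mem_filter.mpr ⟨Finset.mem_erase.mpr ⟨Finset.nonempty_iff_ne_empty.mp hQne, hQF⟩, hTQ m⟩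
        rw [← Finset.add_sum_erase _ _ hQt] at step
        have e2 : ((F.erase ∅).filter (fun ζ => T m ⊆ ζ)).erase Q = R.filter (fun ζ => T m ⊆ ζ) := by
          ext ζ; simp only [hR, Finset.mem_erase, Finset.mem_filter]; tauto
        rw [e2] at step
        have e3 : ∑ ζ ∈ R.filter (fun ζ => T m ⊆ ζ), g ζ = ∑ ζ ∈ R.filter (fun ζ => T m ⊆ ζ), lev ζ := by
          refine Finset.sum_congr rfl fun ζ hζ => ?_
          have hζQ : ζ ≠ Q := ((hmemR ζ).mp (Finset.mem_filter.mp hζ).1).2.2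
          simp only [hg, if_neg hζQ]
        rw [e3] at step
        have e4 : g Q = if m = 0 then 0 else star := by simp only [hg, if_pos rfl]
        rw [e4] at step
        linarith
      · -- injectivity
        intro η₁ hη₁ η₂ hη₂ heq
        have h1 := hdisj η₁ hη₁; have h2 := hdisj η₂ hη₂
        have e1 : (η₁ ∪ T m) \ T m = η₁ := by rw [Finset.union_sdiff_right, Finset.sdiff_eq_self_of_disjoint h1]
        have e2 : (η₂ ∪ T m) \ T m = η₂ := by rw [Finset.union_sdiff_right, Finset.sdiff_eq_self_of_disjoint h2]
        have : (η₁ ∪ T m) \ T m = (η₂ ∪ T m) \ T m := by simp only at heq; rw [heq]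
        rwa [e1, e2] at this
      · -- maps into the target
        intro η hη
        obtain ⟨hηDom, _⟩ := Finset.mem_filter.mp hη
        obtain ⟨hηF, _⟩ := hDomF η hηDom
        refine Finset.mem_filter.mpr ⟨Finset.mem_erase.mpr ⟨?_, ?_⟩, Finset.subset_union_right⟩
        · intro h0
          exact hDom0 η hηDom (Finset.subset_empty.mp (h0 ▸ Finset.subset_union_left))
        · exact hFup η hηF (η ∪ T m) Finset.subset_union_left (Finset.union_subset (hFQ η hηF) (hTQ m))
      · -- weights
        intro η hη
        obtain ⟨hηDom, hmj⟩ := Finset.mem_filter.mp hη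
        obtain ⟨hηF, hηQ⟩ := hDomF η hηDom
        have hsubQ : η ∪ T m ⊆ Q := Finset.union_subset (hFQ η hηF) (hTQ m)
        simp only [hg]
        by_cases hQ : η ∪ T m = Q
        · rw [if_pos hQ]
          by_cases hm0 : m = 0
          · exfalso; apply hηQ
            rw [← hQ, hm0, hT0, Finset.union_empty]
          · rw [if_neg hm0]
            -- η = Q \ T m ⊆ Q \ T 1 = ηs, and ηs ∈ F
            have hηsub : η ⊆ ηs := by
              intro x hx
              refine Finset.mem_sdiff.mpr ⟨hFQ η hηF hx, fun hx1 => ?_⟩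
              exact (Finset.disjoint_left.mp (hdisj η hη)) hx (hTmono 1 m (Nat.one_le_iff_ne_zero.mpr hm0) hx1)
            have hηsF : ηs ∈ F := hFup η hηF ηs hηsub hηsQ
            rw [hstar, if_pos hηsF]
            exact hlevmono η ηs hηsub hηsQ
        · rw [if_neg hQ]
          exact hlevmono η (η ∪ T m) Finset.subset_union_left hsubQ
      · -- g ≥ 0 on the target
        intro ζ _
        simp only [hg]
        split_ifs
        · exact le_refl 0
        · exact hstar0
        · exact hlev0 ζ
    -- (D) resum over thresholds
    have hD1 : ∑ m ∈ Finset.range (L + 1), Δ m * ((∑ ζ ∈ R.filter (fun ζ => T m ⊆ ζ), lev ζ) + (if m = 0 then 0 else star))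
        = (∑ ζ ∈ R, lev ζ * ∑ m ∈ Finset.range (L + 1), (if T m ⊆ ζ then Δ m else 0)) + star * (Rf L - Rf 0) := by
      have e1 : ∀ m ∈ Finset.range (L + 1), Δ m * ((∑ ζ ∈ R.filter (fun ζ => T m ⊆ ζ), lev ζ) + (if m = 0 then 0 else star))
          = (∑ ζ ∈ R, (if T m ⊆ ζ then Δ m * lev ζ else 0)) + star * (if m = 0 then 0 else Δ m) := by
        intro m _
        rw [mul_add, Finset.sum_filter, Finset.mul_sum]
        congr 1
        · refine Finset.sum_congr rfl fun ζ _ => ?_; split_ifs <;> ring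
        · split_ifs <;> ring
      rw [Finset.sum_congr rfl e1, Finset.sum_add_distrib, Finset.sum_comm, ← Finset.mul_sum]
      congr 1
      · refine Finset.sum_congr rfl fun ζ _ => ?_
        rw [Finset.mul_sum]
        refine Finset.sum_congr rfl fun m _ => ?_; split_ifs <;> ring
      · congr 1
        -- Σ_{m ≤ L, m ≠ 0} Δ m = Rf L - Rf 0
        have t1 : ∑ m ∈ Finset.range (L + 1), (if m ≤ L then Δ m else 0) = Rf L := tele Δ Rf hΔ L (le_refl L)
        have t2 : ∑ m ∈ Finset.range (L + 1), (if m ≤ L then Δ m else 0) = ∑ m ∈ Finset.range (L + 1), Δ m :=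
          Finset.sum_congr rfl fun m hm => by rw [if_pos (Nat.lt_succ_iff.mp (Finset.mem_range.mp hm))]
        have t3 : ∑ m ∈ Finset.range (L + 1), Δ m
            = (∑ m ∈ Finset.range (L + 1), (if m = 0 then 0 else Δ m)) + ∑ m ∈ Finset.range (L + 1), (if m = 0 then Δ m else 0) := by
          rw [← Finset.sum_add_distrib]; refine Finset.sum_congr rfl fun m _ => ?_; split_ifs <;> ring
        have t4 : ∑ m ∈ Finset.range (L + 1), (if m = 0 then Δ m else 0) = Rf 0 := by
          rw [Finset.sum_ite_eq' (Finset.range (L + 1)) 0 (fun m => Δ m)]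
          · simp only [Finset.mem_range, Nat.zero_lt_succ, if_true]; rw [hΔ 0, if_pos rfl]
        linarith
    calc ∑ η ∈ D, lev η * ex η ≤ ∑ η ∈ Dom, lev η * Rf (jb η) := hA
      _ = ∑ m ∈ Finset.range (L + 1), Δ m * ∑ η ∈ Dom.filter (fun η => m ≤ jb η), lev η := hB
      _ ≤ ∑ m ∈ Finset.range (L + 1), Δ m * ((∑ ζ ∈ R.filter (fun ζ => T m ⊆ ζ), lev ζ) + (if m = 0 then 0 else star)) :=
          Finset.sum_le_sum fun m hm => mul_le_mul_of_nonneg_left (hC m hm) (hΔ0 m)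
      _ = _ := hD1
  have crossK := cross a q ΔQ Qf astar ha0 hq0 hamono (fun η hF hQ hD => (haoff η hF hQ hD).1) hqjb (fun m => rfl) hΔQ0 rfl
  have crossH := cross c p ΔP Pf cstar hc0 hp0 hcmono (fun η hF hQ hD => (haoff η hF hQ hD).2) hpjb (fun m => rfl) hΔP0 rfl
  -- STEP 2: squares and supply restricted to R
  have sq : ∑ ζ ∈ R, a ζ * c ζ ≤ ∑ η ∈ D, a η * c η :=
    Finset.sum_le_sum_of_subset_of_nonneg hRD fun η _ _ => mul_nonneg (ha0 η) (hc0 η)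
  have hQmem : Q ∈ F.erase ∅ := Finset.mem_erase.mpr ⟨Finset.nonempty_iff_ne_empty.mp hQne, hQF⟩
  have sup : ∑ ζ ∈ F.erase ∅, Hs ζ * Ks ζ = (∑ ζ ∈ R, Hs ζ * Ks ζ) + Hs Q * Ks Q := by
    rw [hR, Finset.sum_erase_add _ _ hQmem]
  -- the three sums over D combined
  have eD : ∑ η ∈ D, (a η * c η - a η * q η - c η * p η)
      = (∑ η ∈ D, a η * c η) - (∑ η ∈ D, a η * q η) - ∑ η ∈ D, c η * p η := by
    rw [← Finset.sum_sub_distrib, ← Finset.sum_sub_distrib]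
  rw [eD, sup]
  -- STEP 3: pointwise budgets on R
  have hHs0 : ∀ ζ, ζ ⊆ Q → 0 ≤ Hs ζ := fun ζ hζ => le_trans (ha0 ζ) (hHa ζ hζ)
  have hKs0 : ∀ ζ, ζ ⊆ Q → 0 ≤ Ks ζ := fun ζ hζ => le_trans (hc0 ζ) (hKc ζ hζ)
  have bracket_nonneg : ∀ ζ ∈ R, 0 ≤ Hs ζ * Ks ζ + a ζ * c ζ - a ζ * SQ ζ - c ζ * SP ζ := by
    intro ζ hζ
    obtain ⟨hζF, _, _⟩ := (hmemR ζ).mp hζ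
    have hζQ := hFQ ζ hζF
    have h1 : SQ ζ ≤ Ks ζ := le_trans (hS_le ΔQ Qf (fun m => rfl) hΔQ0 ζ hζF) (hKjr ζ hζF)
    have h2 : SP ζ ≤ Hs ζ := le_trans (hS_le ΔP Pf (fun m => rfl) hΔP0 ζ hζF) (hHjr ζ hζF)
    nlinarith [mul_nonneg (sub_nonneg.mpr (hHa ζ hζQ)) (sub_nonneg.mpr (hKc ζ hζQ)), mul_nonneg (ha0 ζ) (sub_nonneg.mpr h1),
      mul_nonneg (hc0 ζ) (sub_nonneg.mpr h2)]
  have eR : ∑ ζ ∈ R, (Hs ζ * Ks ζ + a ζ * c ζ - a ζ * SQ ζ - c ζ * SP ζ)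
      = (∑ ζ ∈ R, Hs ζ * Ks ζ) + (∑ ζ ∈ R, a ζ * c ζ) - (∑ ζ ∈ R, a ζ * SQ ζ) - ∑ ζ ∈ R, c ζ * SP ζ := by
    rw [← Finset.sum_add_distrib, ← Finset.sum_sub_distrib, ← Finset.sum_sub_distrib]
  by_cases hsR : ηs ∈ R
  · -- the co-atom is a partner: pay the top jointly with it
    obtain ⟨hsF, _, _⟩ := (hmemR ηs).mp hsR
    have ea : astar = a ηs := by simp only [hastar, if_pos hsF]
    have ec : cstar = c ηs := by simp only [hcstar, if_pos hsF]
    have hSQs : SQ ηs = Qf 0 := hS_star ΔQ Qf (fun m => rfl)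
    have hSPs : SP ηs = Pf 0 := hS_star ΔP Pf (fun m => rfl)
    have rest := Finset.sum_nonneg fun ζ (hζ : ζ ∈ R.erase ηs) => bracket_nonneg ζ (Finset.mem_of_mem_erase hζ)
    rw [← Finset.sum_erase_add _ _ hsR] at eR
    have joint : 0 ≤ (Hs ηs * Ks ηs + a ηs * c ηs - a ηs * SQ ηs - c ηs * SP ηs) + Hs Q * Ks Q
        - astar * (Qf L - Qf 0) - cstar * (Pf L - Pf 0) := by
      rw [ea, ec, hSQs, hSPs, hHstar, hKstar]
      nlinarith [mul_nonneg (sub_nonneg.mpr (hHstar ▸ hHa ηs hηsQ)) (sub_nonneg.mpr (hKstar ▸ hKc ηs hηsQ)),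
        mul_nonneg (ha0 ηs) (sub_nonneg.mpr hKL), mul_nonneg (hc0 ηs) (sub_nonneg.mpr hHL),
        mul_nonneg (hHs0 Q (le_refl Q)) (hKs0 Q (le_refl Q)), mul_nonneg (ha0 ηs) hQf0, mul_nonneg (hc0 ηs) hPf0]
    linarith [crossK, crossH, sq, rest, joint, eR]
  · -- the co-atom is not a partner: then nothing was charged to the top
    have hzero : astar * (Qf L - Qf 0) = 0 ∧ cstar * (Pf L - Pf 0) = 0 := by
      by_cases hsF : ηs ∈ F
      · have hs0 : ηs = ∅ := by
          by_contra hne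
          exact hsR ((hmemR ηs).mpr ⟨hsF, hne, hηsne⟩)
        have ea : astar = 0 := by rw [hastar, if_pos hsF, hs0]; exact ha_empty.1
        have ec : cstar = 0 := by rw [hcstar, if_pos hsF, hs0]; exact ha_empty.2
        exact ⟨by rw [ea, zero_mul], by rw [ec, zero_mul]⟩
      · simp only [hastar, hcstar, if_neg hsF, zero_mul, and_self]
    have rest := Finset.sum_nonneg bracket_nonneg
    have hQ0 : 0 ≤ Hs Q * Ks Q := mul_nonneg (hHs0 Q (le_refl Q)) (hKs0 Q (le_refl Q))
    linarith [crossK, crossH, sq, rest, hzero.1, hzero.2, eR]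

end Coefficientwise

end Summit.CriticalPhenomena.PercolationContinuityZ3.Theorems
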